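import Summits.BirchSwinnertonDyer.BirchSwinnertonDyer.Theorems.KolyvaginRoadThreeSchneiderTamAtThreeHeightLogNumeratorDeepWeierstrassPCore
import HarnessLib

/-!
# Crux `SchneiderTamAtThree` (item 19154) — THE HEIGHT IS THE LOGARITHM OF THE NUMERATOR, DEEP POINTS,
# part 3a′: the conversion `ℓ² → x⁻¹` and the `ℓ⁴`-level cancellation (abstract bookkeeping)

HONEST FRAMING (cell `bsd-stepL`, seat `bsd-stepL-tam3-p2` g2, WIDTH-LEVER second lane «closed-form Schneider
local factor at 3 … finite case table proved once»; `--supports stmt-BirchSwinnertonDyer-19154 --as helper`):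
THEOREMS ONLY, unconditional, route-independent; 0 definitions, 0 named facts, 0 sorry; pure `ℚ₃`-algebra
lemmas used by the deep-point law (part 3b); nothing here proves the crux, Schneider's conjecture or BSD.

* `norm_omega_sub_kappa_mul_le` — the `x⁻²`-coefficient `(6c₄ − 5b₂² − C²)/1440 − ((C − b₂)/12)(b₂/12) =
  −((C − b₂)² + 12b₂(C − b₂) + 144b₄)/1440` is a `3`-adic integer when `‖C − b₂‖ ≤ 3⁻¹`.
* `deep_conversion` — from the fourth-order relation `‖Xℓ² − 1 + (b₂/12)ℓ² − (c₄/240)ℓ⁴‖ ≤ r⁴`: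
  `‖κ_C(ℓ² − (X⁻¹ − (b₂/12)X⁻²))‖, ‖Ω(ℓ⁴ − X⁻²)‖, ‖(Ω − κ_C b₂/12)X⁻²‖ ≤ r⁴`.

References: [SilvermanAEC2009] IV.1, VII.2; tree: deep parts 1, 2a.
-/

noncomputable section

open scoped Classical Nat
open Filter Topology IsUltrametricDist PowerSeries
open WeierstrassCurve Literature.NumberTheory.EllipticCurves
open Literature.NumberTheory.EllipticCurves.SteinWuthrich2013
open Literature.NumberTheory.EllipticCurves.TateCurve
open Literature.NumberTheory.EllipticCurves.Rank1Residual
open Summit.BirchSwinnertonDyer.Uniform.UI.O2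

namespace Summit.BirchSwinnertonDyer.Rank1Residual.X11b.RegMult.HeightLogNumerator

/-! ### §8a Conversion lemmas -/

section Conversion

/-- **The `x⁻²`-coefficient of the closed form is a `3`-adic integer.** For `‖C − b₂‖ ≤ 3⁻¹`,
`‖b₂‖, ‖b₄‖ ≤ 1` and `c₄ = b₂² − 24b₄`:
`(6c₄ − 5b₂² − C²)/1440 − ((C − b₂)/12)(b₂/12) = −((C − b₂)² + 12b₂(C − b₂) + 144b₄)/1440` has norm `≤ 1`
(`‖1/1440‖₃ = 9`, each summand of the numerator has norm `≤ 3⁻²`). This is the `ℓ⁴`-level cancellation of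
the deep-point law. [folklore] -/
theorem norm_omega_sub_kappa_mul_le {C b₂ b₄ : ℚ_[3]} (hCb : ‖C - b₂‖ ≤ 1 / 3) (hb2 : ‖b₂‖ ≤ 1)
    (hb4 : ‖b₄‖ ≤ 1) :
    ‖(6 * (b₂ ^ 2 - 24 * b₄) - 5 * b₂ ^ 2 - C ^ 2) / 1440 - (C - b₂) / 12 * (b₂ / 12)‖ ≤ 1 := by
  have h1440 : ‖(1440 : ℚ_[3])⁻¹‖ = 9 := by
    have h160 : ‖(160 : ℚ_[3])‖ = 1 := by
      simpa using Padic.norm_natCast_eq_one_iff.mpr (show Nat.Coprime 3 160 by decide)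
    have h3i : ‖(3 : ℚ_[3])⁻¹‖ = 3 := by
      rw [norm_inv, show (3 : ℚ_[3]) = ((3 : ℕ) : ℚ_[3]) by norm_cast, Padic.norm_p]; norm_num
    rw [show (1440 : ℚ_[3]) = 160 * (3 * 3) by norm_num, mul_inv, mul_inv, norm_mul, norm_mul, h3i, norm_inv,
      h160]; norm_num
  have h12 : ‖(12 : ℚ_[3])‖ ≤ 1 / 3 := by
    rw [show (12 : ℚ_[3]) = ((4 : ℤ) : ℚ_[3]) * 3 by norm_num, norm_mul,
      show (3 : ℚ_[3]) = ((3 : ℕ) : ℚ_[3]) by norm_cast, Padic.norm_p]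
    calc ‖((4 : ℤ) : ℚ_[3])‖ * (↑(3 : ℕ) : ℝ)⁻¹ ≤ 1 * (↑(3 : ℕ) : ℝ)⁻¹ := by
          gcongr; exact Padic.norm_int_le_one 4
      _ = 1 / 3 := by norm_num
  have h144 : ‖(144 : ℚ_[3])‖ ≤ 1 / 9 := by
    rw [show (144 : ℚ_[3]) = 12 * 12 by norm_num, norm_mul]
    calc ‖(12 : ℚ_[3])‖ * ‖(12 : ℚ_[3])‖ ≤ (1 / 3) * (1 / 3) := by gcongr
      _ = 1 / 9 := by norm_num
  have e : (6 * (b₂ ^ 2 - 24 * b₄) - 5 * b₂ ^ 2 - C ^ 2) / 1440 - (C - b₂) / 12 * (b₂ / 12) =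
      -((1440 : ℚ_[3])⁻¹ * ((C - b₂) ^ 2 + 12 * b₂ * (C - b₂) + 144 * b₄)) := by
    field_simp
    ring
  rw [e, norm_neg, norm_mul, h1440]
  have hin : ‖(C - b₂) ^ 2 + 12 * b₂ * (C - b₂) + 144 * b₄‖ ≤ 1 / 9 := by
    refine (norm_add_le_max _ _).trans (max_le ((norm_add_le_max _ _).trans (max_le ?_ ?_)) ?_)
    · rw [norm_pow]
      calc ‖C - b₂‖ ^ 2 ≤ (1 / 3) ^ 2 := by gcongr
        _ = 1 / 9 := by norm_num
    · rw [norm_mul, norm_mul]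
      calc ‖(12 : ℚ_[3])‖ * ‖b₂‖ * ‖C - b₂‖ ≤ (1 / 3) * 1 * (1 / 3) := by gcongr
        _ = 1 / 9 := by norm_num
    · rw [norm_mul]
      calc ‖(144 : ℚ_[3])‖ * ‖b₄‖ ≤ (1 / 9) * 1 := by gcongr
        _ = 1 / 9 := mul_one _
  calc 9 * ‖(C - b₂) ^ 2 + 12 * b₂ * (C - b₂) + 144 * b₄‖ ≤ 9 * (1 / 9) := by gcongr
    _ = 1 := by norm_num

/-- **Conversion `ℓ² → x⁻¹` and the sizes of the closed-form coefficients** (abstract bookkeeping for the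
deep-point law). For `X, ℓ, b₂, b₄, C ∈ ℚ₃` with `‖X⁻¹‖ = r²`, `‖ℓ‖ = r`, `0 < r ≤ 3⁻²`, `‖b₂‖, ‖b₄‖ ≤ 1`,
`‖C‖ = 1`, `‖C − b₂‖ ≤ 3⁻¹` and the fourth-order relation `‖Xℓ² − 1 + (b₂/12)ℓ² − (c₄/240)ℓ⁴‖ ≤ r⁴`
(`c₄ = b₂² − 24b₄`): with `κ_C = (C − b₂)/12`, `Ω = (6c₄ − 5b₂² − C²)/1440`,
`‖κ_C·(ℓ² − (X⁻¹ − (b₂/12)X⁻²))‖ ≤ r⁴`, `‖Ω·(ℓ⁴ − X⁻²)‖ ≤ r⁴`, `‖(Ω − κ_C b₂/12)·X⁻²‖ ≤ r⁴`. [folklore] -/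
theorem deep_conversion {X ℓ b₂ b₄ C : ℚ_[3]} {r : ℝ} (hX0 : X ≠ 0) (hXi2 : ‖X⁻¹‖ = r ^ 2) (hℓn : ‖ℓ‖ = r)
    (hr : 0 < r) (hr9 : r ≤ 1 / 9) (hb2n : ‖b₂‖ ≤ 1) (hb4n : ‖b₄‖ ≤ 1) (hCi : ‖C‖ = 1)
    (hCb : ‖C - b₂‖ ≤ 1 / 3)
    (hXℓ : ‖X * ℓ ^ 2 - 1 + b₂ / 12 * ℓ ^ 2 - (b₂ ^ 2 - 24 * b₄) / 240 * ℓ ^ 4‖ ≤ r ^ 4) :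
    ‖(C - b₂) / 12 * (ℓ ^ 2 - (X⁻¹ - b₂ / 12 * X⁻¹ ^ 2))‖ ≤ r ^ 4 ∧
      ‖(6 * (b₂ ^ 2 - 24 * b₄) - 5 * b₂ ^ 2 - C ^ 2) / 1440 * (ℓ ^ 4 - X⁻¹ ^ 2)‖ ≤ r ^ 4 ∧
      ‖((6 * (b₂ ^ 2 - 24 * b₄) - 5 * b₂ ^ 2 - C ^ 2) / 1440 - (C - b₂) / 12 * (b₂ / 12)) * X⁻¹ ^ 2‖
        ≤ r ^ 4 := by
  obtain ⟨hz1, h3z, h9z, h27z2, h3z2, hz2le, -, hr6, -, -, -, -, -, -⟩ := deep_numerics r hr hr9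
  obtain ⟨h2n, h4n, h3n, h3i, h9i, h12i, -, -, -, -⟩ := padic_three_constants
  set c₄ : ℚ_[3] := b₂ ^ 2 - 24 * b₄ with hc4def
  have hb12 : ‖b₂ / 12‖ ≤ 3 := by
    rw [div_eq_mul_inv, norm_mul, h12i]
    calc ‖b₂‖ * 3 ≤ 1 * 3 := by gcongr
      _ = 3 := one_mul _
  have hc4n : ‖c₄‖ ≤ 1 := by
    rw [hc4def]
    refine (norm_sub_le_max₃ _ _).trans (max_le ?_ ?_)
    · rw [norm_pow]; exact pow_le_one₀ (norm_nonneg _) hb2n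
    · rw [norm_mul]
      have h24 : ‖(24 : ℚ_[3])‖ ≤ 1 := by
        have h : ((24 : ℤ) : ℚ_[3]) = 24 := by norm_cast
        rw [← h]; exact Padic.norm_int_le_one 24
      calc ‖(24 : ℚ_[3])‖ * ‖b₄‖ ≤ 1 * 1 := by gcongr
        _ = 1 := one_mul _
  have h240i : ‖(240 : ℚ_[3])⁻¹‖ = 3 := by
    have h80 : ‖(80 : ℚ_[3])‖ = 1 := by
      simpa using Padic.norm_natCast_eq_one_iff.mpr (show Nat.Coprime 3 80 by decide)
    rw [show (240 : ℚ_[3]) = 80 * 3 by norm_num, mul_inv, norm_mul, h3i, norm_inv, h80]; norm_num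
  set u : ℚ_[3] := X * ℓ ^ 2 - 1 with hudef
  have hu : ‖u‖ ≤ 3 * r ^ 2 := by
    have e : u = (X * ℓ ^ 2 - 1 + b₂ / 12 * ℓ ^ 2 - c₄ / 240 * ℓ ^ 4) - b₂ / 12 * ℓ ^ 2 +
        c₄ / 240 * ℓ ^ 4 := by rw [hudef]; ring
    rw [e]
    refine (norm_add_le_max _ _).trans (max_le ((norm_sub_le_max₃ _ _).trans (max_le (hXℓ.trans ?_) ?_)) ?_)
    · calc r ^ 4 = r ^ 2 * r ^ 2 := by ring
        _ ≤ 1 * r ^ 2 := by gcongr; exact pow_le_one₀ hr.le hz1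
        _ ≤ 3 * r ^ 2 := by linarith [pow_nonneg hr.le 2]
    · rw [norm_mul, norm_pow, hℓn]
      exact mul_le_mul_of_nonneg_right hb12 (by positivity)
    · rw [norm_mul, norm_pow, hℓn, div_eq_mul_inv, norm_mul, h240i]
      calc ‖c₄‖ * 3 * r ^ 4 ≤ 1 * 3 * r ^ 4 := by gcongr
        _ = 3 * (r ^ 2 * r ^ 2) := by ring
        _ ≤ 3 * (r ^ 2 * 1) := by gcongr; exact pow_le_one₀ hr.le hz1
        _ = 3 * r ^ 2 := by ring
  have hℓ2 : ℓ ^ 2 = X⁻¹ * (1 + u) := by rw [hudef]; field_simp; ring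
  have hconv1 : ‖ℓ ^ 2 - (X⁻¹ - b₂ / 12 * X⁻¹ ^ 2)‖ ≤ r ^ 4 := by
    have e : ℓ ^ 2 - (X⁻¹ - b₂ / 12 * X⁻¹ ^ 2) =
        X⁻¹ * (X * ℓ ^ 2 - 1 + b₂ / 12 * ℓ ^ 2 - c₄ / 240 * ℓ ^ 4) + c₄ / 240 * (X⁻¹ * ℓ ^ 4) -
          b₂ / 12 * (X⁻¹ ^ 2 * u) := by
      rw [hudef]; field_simp; ring
    rw [e]
    refine (norm_sub_le_max₃ _ _).trans (max_le ((norm_add_le_max _ _).trans (max_le ?_ ?_)) ?_)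
    · rw [norm_mul, hXi2]
      calc r ^ 2 * ‖X * ℓ ^ 2 - 1 + b₂ / 12 * ℓ ^ 2 - c₄ / 240 * ℓ ^ 4‖ ≤ r ^ 2 * r ^ 4 := by gcongr
        _ = r ^ 4 * r ^ 2 := by ring
        _ ≤ r ^ 4 * 1 := by gcongr; exact pow_le_one₀ hr.le hz1
        _ = r ^ 4 := mul_one _
    · rw [norm_mul, norm_mul, hXi2, norm_pow, hℓn, div_eq_mul_inv, norm_mul, h240i]
      calc ‖c₄‖ * 3 * (r ^ 2 * r ^ 4) ≤ 1 * 3 * (r ^ 2 * r ^ 4) := by gcongr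
        _ = (3 * r ^ 2) * r ^ 4 := by ring
        _ ≤ 1 * r ^ 4 := by gcongr
        _ = r ^ 4 := one_mul _
    · rw [norm_mul, norm_mul, norm_pow, hXi2]
      calc ‖b₂ / 12‖ * ((r ^ 2) ^ 2 * ‖u‖) ≤ 3 * ((r ^ 2) ^ 2 * (3 * r ^ 2)) := by gcongr
        _ = (9 * r ^ 2) * r ^ 4 := by ring
        _ ≤ 1 * r ^ 4 := by gcongr; linarith
        _ = r ^ 4 := one_mul _
  have hconv2 : ‖ℓ ^ 4 - X⁻¹ ^ 2‖ ≤ 3 * r ^ 6 := by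
    rw [show ℓ ^ 4 - X⁻¹ ^ 2 = (ℓ ^ 2 - X⁻¹) * (ℓ ^ 2 + X⁻¹) by ring, norm_mul]
    have h1 : ‖ℓ ^ 2 - X⁻¹‖ ≤ 3 * r ^ 4 := by
      rw [hℓ2, show X⁻¹ * (1 + u) - X⁻¹ = X⁻¹ * u by ring, norm_mul, hXi2]
      calc r ^ 2 * ‖u‖ ≤ r ^ 2 * (3 * r ^ 2) := by gcongr
        _ = 3 * r ^ 4 := by ring
    have h2 : ‖ℓ ^ 2 + X⁻¹‖ ≤ r ^ 2 :=
      (norm_add_le_max _ _).trans (max_le (by rw [norm_pow, hℓn]) hXi2.le)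
    calc ‖ℓ ^ 2 - X⁻¹‖ * ‖ℓ ^ 2 + X⁻¹‖ ≤ (3 * r ^ 4) * r ^ 2 := by gcongr
      _ = 3 * r ^ 6 := by ring
  have hκC : ‖(C - b₂) / 12‖ ≤ 1 := by
    rw [div_eq_mul_inv, norm_mul, h12i]
    calc ‖C - b₂‖ * 3 ≤ (1 / 3) * 3 := by gcongr
      _ = 1 := by norm_num
  have hΩn : ‖(6 * c₄ - 5 * b₂ ^ 2 - C ^ 2) / 1440‖ ≤ 9 := by
    have h1440 : ‖(1440 : ℚ_[3])⁻¹‖ = 9 := by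
      have h160 : ‖(160 : ℚ_[3])‖ = 1 := by
        simpa using Padic.norm_natCast_eq_one_iff.mpr (show Nat.Coprime 3 160 by decide)
      rw [show (1440 : ℚ_[3]) = 160 * (3 * 3) by norm_num, mul_inv, mul_inv, norm_mul, norm_mul, h3i,
        norm_inv, h160]; norm_num
    rw [div_eq_mul_inv, norm_mul, h1440]
    have h6 : ‖(6 : ℚ_[3])‖ ≤ 1 := by
      have h : ((6 : ℤ) : ℚ_[3]) = 6 := by norm_cast
      rw [← h]; exact Padic.norm_int_le_one 6
    have h5 : ‖(5 : ℚ_[3])‖ ≤ 1 := by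
      have h : ((5 : ℤ) : ℚ_[3]) = 5 := by norm_cast
      rw [← h]; exact Padic.norm_int_le_one 5
    have hin : ‖6 * c₄ - 5 * b₂ ^ 2 - C ^ 2‖ ≤ 1 := by
      refine (norm_sub_le_max₃ _ _).trans (max_le ((norm_sub_le_max₃ _ _).trans (max_le ?_ ?_)) ?_)
      · rw [norm_mul]
        calc ‖(6 : ℚ_[3])‖ * ‖c₄‖ ≤ 1 * 1 := by gcongr
          _ = 1 := one_mul _
      · rw [norm_mul, norm_pow]
        calc ‖(5 : ℚ_[3])‖ * ‖b₂‖ ^ 2 ≤ 1 * 1 ^ 2 := by gcongr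
          _ = 1 := by norm_num
      · rw [norm_pow, hCi]; norm_num
    exact (mul_le_mul_of_nonneg_right hin (by norm_num)).trans (by norm_num)
  have hΩ := norm_omega_sub_kappa_mul_le hCb hb2n hb4n
  refine ⟨?_, ?_, ?_⟩
  · rw [norm_mul]
    calc ‖(C - b₂) / 12‖ * _ ≤ 1 * r ^ 4 := mul_le_mul hκC hconv1 (norm_nonneg _) zero_le_one
      _ = r ^ 4 := one_mul _
  · rw [norm_mul]
    calc ‖(6 * c₄ - 5 * b₂ ^ 2 - C ^ 2) / 1440‖ * _ ≤ 9 * (3 * r ^ 6) :=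
          mul_le_mul hΩn hconv2 (norm_nonneg _) (by norm_num)
      _ = (27 * r ^ 2) * r ^ 4 := by ring
      _ ≤ 1 * r ^ 4 := by gcongr
      _ = r ^ 4 := one_mul _
  · rw [norm_mul, norm_pow, hXi2]
    calc ‖(6 * c₄ - 5 * b₂ ^ 2 - C ^ 2) / 1440 - (C - b₂) / 12 * (b₂ / 12)‖ * (r ^ 2) ^ 2
        ≤ 1 * (r ^ 2) ^ 2 := by gcongr
      _ = r ^ 4 := by ring

end Conversion

end Summit.BirchSwinnertonDyer.Rank1Residual.X11b.RegMult.HeightLogNumerator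

end
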